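import Summits.QuantumFields.YangMills.Theorems.BalabanUVNodesN20ClassLawConditionalHybridBoundMarginals
import Summits.QuantumFields.YangMills.Theorems.BalabanUVNodesN20BlockCaricatureClosedForm
import Summits.QuantumFields.YangMills.Theorems.BalabanUVNodesN20InhomogeneousBlockCaricature

/-!
# BalabanUVNodes ∕ N20·N19′·N21 — ON THE PRODUCT CARICATURE THE CONDITIONAL SUM IS EXACTLY THE BLOCK-DISCREPANCY LETTER, AND AT POLYNOMIALLY GROWING WINDOWS IN THE BULK THAT LETTER IS
# NOT NECESSARY (FILE X): the marginals of a product-Bernoulli law are the product laws of the first `i` blocks, so FILE V's mass-weighted conditional sum of two product laws equals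
# `Σ_{i<n} |p_i − q_i|` on the nose (FILE T ⊇ FILE Q exactly); and a bulk family (`n_K = (K+1)⁶` exchangeable blocks, `p = ½`, `q_K = ½ + ¼(K+1)⁻⁵`) HAS stub 2's dials (FILE K's closed
# form: `Δ_K∕σ_K ≍ (K+1)⁻²` summable) while its conditional ∕ block-discrepancy letter DIVERGES (`Σ_K n_K|q_K − p_K| = Σ ¼(K+1) = ∞`) — so FILE W's necessity is a BOUNDED-window fact

Cell `pub-ymgap` (HUMAN RULING D-0062 Track A; work-bound push D-0149, director-ym №197), width seat `pub-ymgap-dag-n20-w1` (gen 7) on node N20 = NE7b; key item of this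
seat's payload K3⁷ `SpineGivenEndpointR13SepCoPH` = stmt-QuantumFields-20544 (ASIDE; lineage of K3⁸ `SpineGivenEndpointR13SepCoPHV` = stmt-QuantumFields-27366, skeleton v6
b4e55110ab73e679 UNTOUCHED; `--kind proof --supports 20544 --as helper`, MIS-KEY rule R463 (4)(a)); COUNT-NEUTRAL.  Bus: CLAIM-28 ∕ INTENT-33.
THEOREMS ONLY (0 def ∕ instance ∕ notation ∕ sorry); imports this seat's FILE V p641279 (marginal towers), FILE K p625658 (closed-form caricature criterion) and FILE Q p635927
(product-Bernoulli weights with per-block rates) BY NAME.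

WHY.  FILES T∕V∕W priced the class-law half of K3 stub 2 WITHOUT independence by the mass-weighted conditional sum and showed it NECESSARY at bounded windows (W: `condsum ≤ 4n_K·ρ_K`).
Two loose ends, closed here.  (1) CONSISTENCY WITH THE CARICATURE: for product-Bernoulli weights the level-`i` marginal IS the product law of the first `i` blocks (§1 ★
`marginal_prodConfig`, by induction on the number of blocks with `Finset.sum_powerset_insert` under the filter), so each conditional term is `|p_i − q_i|·w_p^{i}(S)` and the whole
conditional sum is `Σ_{i<n} |p_i − q_i|` EXACTLY (§2 ★★ `condGapSum_prodConfig_eq_blockDiscrepancy`) — FILE T's letter restricted to the caricature is FILE Q's letter, no loss.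
(2) THE FACTOR `n_K` IN W's NECESSITY IS REAL: in the BULK regime of the exchangeable caricature the dials exist iff `Σ_K min(1, Δ_K ∕ max(1, σ_K)) < ∞` (FILE K), which for growing
windows is far weaker than `Σ_K Δ_K < ∞` (`Δ_K = n_K|q_K − p_K|` = the conditional sum here); §3 ★★★ `exists_dials_not_summable_blockDiscrepancy` exhibits `n_K = (K+1)⁶`, `p = ½`,
`q_K = ½ + ¼(K+1)⁻⁵`: dials EXIST (`min(1, Δ∕max(1,σ)) ≤ ½(K+1)⁻²`) but `Σ_K n_K|q_K − p_K| = ∞`.  So: at bounded windows the conditional letter IS the class-law content (W); at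
polynomially growing windows in the bulk it is strictly stronger than needed — consistent with g6's «full key needs relative precision `o((n_K p_K)^{−½})`» (FILE M).
LOCATED READING: the window the plan books should be read with W if its size is bounded in `K`, and with FILE K∕M's bulk order if it grows polynomially; the conditional letter is
the safe SUFFICIENT currency in both cases (T∕V), exact only in the first.

HONEST FRAMING.  [folklore] finite-sum probability on a CARICATURE (independent blocks) and on hypothesis SHAPES; nothing read at the record; proves NO estimate of Bałaban's; refutes NO
registered stub; nothing of Bałaban's asserted or instantiated.  NE7 ∕ NE7b ∕ NE7c NOT PRINTED for `d = 4`, NOT proved; N19 ∕ N20 ∕ N21 NOT discharged; K3⁸ ∕ K3⁷ OPEN; counts unmoved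
(typed 28∕28 · discharged 5∕27); no count claim.  One finite `𝕋⁴_{L^K}` programme at fixed `ε = L^{−K}`, Bałaban AS PRINTED; the YM mass gap (Clay) is NOT proved by any of this — R4 closes
the conditional finite-𝕋⁴ rung `BalabanLadder.UV` only; NOT ℝ⁴, NOT OS.  No decl carries a cite tag.
-/

noncomputable section

open Finset Filter
open Literature.MathematicalPhysics.QuantumFieldTheory.Balaban1983to89
open Literature.MathematicalPhysics.QuantumFieldTheory.Balaban1983to89.T4MatchingAssembly (HybridNE7)
open Summit.QuantumFields.YangMills.BalabanUVNodes.N20InhomogeneousBlockCaricature (sum_prodConfig_eq_one prodConfig_nonneg prodConfig_pos prodConfig_insert_of_notMem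
  prodConfig_insert_insert blockDiscrepancy_const)
open Summit.QuantumFields.YangMills.BalabanUVNodes.N20BlockCaricatureClosedForm (exists_hybridNE7_caricature_iff_summable_closedForm)

namespace Summit.QuantumFields.YangMills.BalabanUVNodes.N20ProductCaricatureConditionalSum

/-! ## §1 The marginals of a product-Bernoulli law are the product laws of the first blocks -/

section Marginals

variable (p : ℕ → ℝ)

/-- A FILTERED powerset sum over `insert n U` splits like `Finset.sum_powerset_insert` when the predicate does not see the new block. [bookkeeping] -/
theorem sum_filter_powerset_insert {U : Finset ℕ} {a : ℕ} (ha : a ∉ U) (P : Finset ℕ → Prop) [DecidablePred P] (hP : ∀ R ⊆ U, P (insert a R) ↔ P R) (f : Finset ℕ → ℝ) :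
    ∑ R ∈ (insert a U).powerset.filter P, f R = ∑ R ∈ U.powerset.filter P, (f R + f (insert a R)) := by
  rw [Finset.sum_filter, Finset.sum_filter, Finset.sum_powerset_insert ha, ← Finset.sum_add_distrib]
  refine Finset.sum_congr rfl fun R hR => ?_
  have h := hP R (Finset.mem_powerset.1 hR)
  by_cases hR' : P R
  · rw [if_pos hR', if_pos (h.2 hR'), if_pos hR']
  · rw [if_neg hR', if_neg (fun h' => hR' (h.1 h')), if_neg hR', add_zero]

/-- ★ **THE MARGINALS OF A PRODUCT LAW** [folklore]: for `i ≤ n` and `S ⊆ range i`, `Σ_{R ⊆ range n, R ∩ range i = S} w_p^{range n}(R) = w_p^{range i}(S)` — the blocks beyond `i` integrate out. -/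
theorem marginal_prodConfig {i n : ℕ} (hin : i ≤ n) {S : Finset ℕ} (hS : S ⊆ Finset.range i) :
    ∑ R ∈ (Finset.range n).powerset.filter (fun R => R ∩ Finset.range i = S), (∏ j ∈ R, p j) * ∏ j ∈ Finset.range n \ R, (1 - p j) =
      (∏ j ∈ S, p j) * ∏ j ∈ Finset.range i \ S, (1 - p j) := by
  induction n, hin using Nat.le_induction with
  | base =>
    have e : (Finset.range i).powerset.filter (fun R => R ∩ Finset.range i = S) = {S} := by
      ext R
      simp only [Finset.mem_filter, Finset.mem_powerset, Finset.mem_singleton]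
      constructor
      · rintro ⟨hR, h⟩; rwa [Finset.inter_eq_left.2 hR] at h
      · rintro rfl; exact ⟨hS, Finset.inter_eq_left.2 hS⟩
    rw [e, Finset.sum_singleton]
  | succ n hin IH =>
    have hni : n ∉ Finset.range i := fun h => absurd (Finset.mem_range.1 h) (not_lt.2 hin)
    rw [Finset.range_add_one, sum_filter_powerset_insert Finset.notMem_range_self (fun R => R ∩ Finset.range i = S)
      (fun R _ => by rw [Finset.insert_inter_of_notMem hni]) _]
    rw [← IH]
    refine Finset.sum_congr rfl fun R hR => ?_
    have hR' : R ⊆ Finset.range n := Finset.mem_powerset.1 (Finset.mem_filter.1 hR).1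
    rw [prodConfig_insert_of_notMem Finset.notMem_range_self p hR', prodConfig_insert_insert Finset.notMem_range_self p hR']
    ring

end Marginals

/-! ## §2 The conditional sum of two product laws IS the block-discrepancy letter -/

section CondSum

variable (n : ℕ) (p q : ℕ → ℝ)

/-- ★★ **FILE T ⊇ FILE Q EXACTLY** [folklore ∕ bookkeeping]: for product-Bernoulli weights with run-A rates in `[0, 1]` and run-B rates in `(0, 1)`, FILE V's mass-weighted conditional
sum equals `Σ_{i<n} |q_i − p_i|` — each level-`i` term is `|q_i − p_i|·w_p^{range i}(S)` and the `w_p^{range i}(S)` sum to `1`. -/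
theorem condGapSum_prodConfig_eq_blockDiscrepancy (hp : ∀ i ∈ Finset.range n, 0 ≤ p i ∧ p i ≤ 1) (hq : ∀ i ∈ Finset.range n, 0 < q i ∧ q i < 1) :
    ∑ i ∈ Finset.range n, ∑ S ∈ (Finset.range i).powerset,
        |(∑ R ∈ (Finset.range n).powerset.filter (fun R => R ∩ Finset.range (i + 1) = insert i S), (∏ j ∈ R, p j) * ∏ j ∈ Finset.range n \ R, (1 - p j)) *
            (∑ R ∈ (Finset.range n).powerset.filter (fun R => R ∩ Finset.range i = S), (∏ j ∈ R, q j) * ∏ j ∈ Finset.range n \ R, (1 - q j)) -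
          (∑ R ∈ (Finset.range n).powerset.filter (fun R => R ∩ Finset.range (i + 1) = insert i S), (∏ j ∈ R, q j) * ∏ j ∈ Finset.range n \ R, (1 - q j)) *
            (∑ R ∈ (Finset.range n).powerset.filter (fun R => R ∩ Finset.range i = S), (∏ j ∈ R, p j) * ∏ j ∈ Finset.range n \ R, (1 - p j))| /
          ∑ R ∈ (Finset.range n).powerset.filter (fun R => R ∩ Finset.range i = S), (∏ j ∈ R, q j) * ∏ j ∈ Finset.range n \ R, (1 - q j) =
      ∑ i ∈ Finset.range n, |q i - p i| := by
  refine Finset.sum_congr rfl fun i hi => ?_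
  have hin : i < n := Finset.mem_range.1 hi
  have hpi : ∀ j ∈ Finset.range i, 0 ≤ p j ∧ p j ≤ 1 := fun j hj => hp j (Finset.mem_range.2 ((Finset.mem_range.1 hj).trans hin))
  have hqi : ∀ j ∈ Finset.range i, 0 < q j ∧ q j < 1 := fun j hj => hq j (Finset.mem_range.2 ((Finset.mem_range.1 hj).trans hin))
  have key : ∀ S ∈ (Finset.range i).powerset,
      |(∑ R ∈ (Finset.range n).powerset.filter (fun R => R ∩ Finset.range (i + 1) = insert i S), (∏ j ∈ R, p j) * ∏ j ∈ Finset.range n \ R, (1 - p j)) *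
          (∑ R ∈ (Finset.range n).powerset.filter (fun R => R ∩ Finset.range i = S), (∏ j ∈ R, q j) * ∏ j ∈ Finset.range n \ R, (1 - q j)) -
        (∑ R ∈ (Finset.range n).powerset.filter (fun R => R ∩ Finset.range (i + 1) = insert i S), (∏ j ∈ R, q j) * ∏ j ∈ Finset.range n \ R, (1 - q j)) *
          (∑ R ∈ (Finset.range n).powerset.filter (fun R => R ∩ Finset.range i = S), (∏ j ∈ R, p j) * ∏ j ∈ Finset.range n \ R, (1 - p j))| /
        ∑ R ∈ (Finset.range n).powerset.filter (fun R => R ∩ Finset.range i = S), (∏ j ∈ R, q j) * ∏ j ∈ Finset.range n \ R, (1 - q j) =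
      |q i - p i| * ((∏ j ∈ S, p j) * ∏ j ∈ Finset.range i \ S, (1 - p j)) := by
    intro S hS
    have hS' : S ⊆ Finset.range i := Finset.mem_powerset.1 hS
    have hiS : insert i S ⊆ Finset.range (i + 1) := by rw [Finset.range_add_one]; exact Finset.insert_subset_insert i hS'
    rw [marginal_prodConfig p hin hiS, marginal_prodConfig q hin hiS, marginal_prodConfig p hin.le hS', marginal_prodConfig q hin.le hS']
    -- peel the block `i` off the level-`(i+1)` product weights
    have eP : (∏ j ∈ insert i S, p j) * ∏ j ∈ Finset.range (i + 1) \ insert i S, (1 - p j) = p i * ((∏ j ∈ S, p j) * ∏ j ∈ Finset.range i \ S, (1 - p j)) := by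
      rw [Finset.range_add_one]; exact prodConfig_insert_insert Finset.notMem_range_self p hS'
    have eQ : (∏ j ∈ insert i S, q j) * ∏ j ∈ Finset.range (i + 1) \ insert i S, (1 - q j) = q i * ((∏ j ∈ S, q j) * ∏ j ∈ Finset.range i \ S, (1 - q j)) := by
      rw [Finset.range_add_one]; exact prodConfig_insert_insert Finset.notMem_range_self q hS'
    rw [eP, eQ]
    set X := (∏ j ∈ S, p j) * ∏ j ∈ Finset.range i \ S, (1 - p j)
    set Y := (∏ j ∈ S, q j) * ∏ j ∈ Finset.range i \ S, (1 - q j)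
    have hX : 0 ≤ X := prodConfig_nonneg hpi hS'
    have hY : 0 < Y := prodConfig_pos hqi hS'
    rw [show p i * X * Y - q i * Y * X = (p i - q i) * X * Y by ring, abs_mul (((p i - q i)) * X) Y, abs_mul (p i - q i) X, abs_of_pos hY, abs_of_nonneg hX,
      mul_div_assoc, div_self hY.ne', mul_one, abs_sub_comm]
  rw [Finset.sum_congr rfl key, ← Finset.mul_sum, sum_prodConfig_eq_one, mul_one]

end CondSum

/-! ## §3 A bulk family with dials whose block-discrepancy ∕ conditional letter diverges: FILE W's necessity is a BOUNDED-window fact -/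

/-- ★★★ **DIALS WITHOUT THE CONDITIONAL LETTER AT POLYNOMIALLY GROWING WINDOWS (BULK)** [folklore ∕ bookkeeping]: the exchangeable caricature `n_K = 4(K+1)⁶`, `p_K = ½`,
`q_K = ½ + ¼(K+1)⁻⁵` is in the BULK at every scale (`σ_K ≥ 1`), HAS `HybridNE7` for some dials (FILE K's closed form: `min(1, Δ_K∕max(1,σ_K)) ≤ (K+1)⁻²`, summable), yet its
block-discrepancy letter — which on a product law IS FILE V's conditional sum (§2, `blockDiscrepancy_const`) — DIVERGES: `Σ_{i<n_K} |q_K − p_K| = n_K|q_K − p_K| = K + 1`.  So the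
necessity of FILE W (`condsum ≤ 4n_K·ρ_K`) cannot lose its factor `n_K`: at bounded windows the conditional letter is exact, at polynomially growing windows in the bulk it is
strictly stronger than stub 2's dials require. -/
theorem exists_dials_not_summable_blockDiscrepancy :
    ∃ (nb : ℕ → ℕ) (p q : ℕ → ℝ), (∀ K, 0 < p K ∧ p K < 1) ∧ (∀ K, 0 < q K ∧ q K < 1) ∧
      (∀ K, 1 ≤ Real.sqrt (nb K * max (p K * (1 - p K)) (q K * (1 - q K)))) ∧
      (∃ (Bad : ℕ → ℝ → Finset (Finset ℕ)) (W : ℕ → ℝ) (shA shB : ℕ → ℝ → Finset ℕ → ℝ) (Wsh δ : ℕ → ℝ),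
        HybridNE7 0 1 (fun K => (Finset.range (nb K)).powerset) (fun K _ S => p K ^ S.card * (1 - p K) ^ (nb K - S.card))
          (fun K _ S => q K ^ S.card * (1 - q K) ^ (nb K - S.card)) Bad W shA shB Wsh δ) ∧
      ¬ Summable (fun K => ∑ _i ∈ Finset.range (nb K), |q K - p K|) := by
  refine ⟨fun K => 4 * (K + 1) ^ 6, fun _ => 1 / 2, fun K => 1 / 2 + 1 / (4 * ((K : ℝ) + 1) ^ 5), fun K => ⟨by norm_num, by norm_num⟩, fun K => ?_, fun K => ?_, ?_, ?_⟩
  · have h1 : (0 : ℝ) < 1 / (4 * ((K : ℝ) + 1) ^ 5) := by positivity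
    have h2 : 1 / (4 * ((K : ℝ) + 1) ^ 5) ≤ 1 / 4 := by
      rw [div_le_div_iff₀ (by positivity) (by norm_num)]
      nlinarith [one_le_pow₀ (show (1 : ℝ) ≤ (K : ℝ) + 1 by linarith [(Nat.cast_nonneg K : (0 : ℝ) ≤ K)]) (n := 5)]
    constructor <;> linarith
  · -- bulk: `√(n·max) ≥ √(n∕4) = (K+1)³ ≥ 1`
    have hK1 : (1 : ℝ) ≤ (K : ℝ) + 1 := by linarith [(Nat.cast_nonneg K : (0 : ℝ) ≤ K)]
    calc (1 : ℝ) ≤ ((K : ℝ) + 1) ^ 3 := one_le_pow₀ hK1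
      _ = Real.sqrt ((((K : ℝ) + 1) ^ 3) ^ 2) := (Real.sqrt_sq (by positivity)).symm
      _ ≤ _ := Real.sqrt_le_sqrt (by
          have : (((K : ℝ) + 1) ^ 3) ^ 2 = (4 * ((K : ℝ) + 1) ^ 6) * (1 / 2 * (1 - 1 / 2)) := by ring
          rw [this]; push_cast
          exact mul_le_mul_of_nonneg_left (le_max_left _ _) (by positivity))
  · -- dials, by FILE K's closed form: `min(1, Δ∕max(1,σ)) ≤ Δ∕σ ≤ (K+1)∕(K+1)³`
    refine (exists_hybridNE7_caricature_iff_summable_closedForm (fun K => 4 * (K + 1) ^ 6) (fun _ => 1 / 2) (fun K => 1 / 2 + 1 / (4 * ((K : ℝ) + 1) ^ 5))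
      (fun K => ⟨by norm_num, by norm_num⟩) (fun K => ⟨by positivity, ?_⟩) le_rfl 1).2 ?_
    · have h2 : 1 / (4 * ((K : ℝ) + 1) ^ 5) ≤ 1 / 4 := by
        rw [div_le_div_iff₀ (by positivity) (by norm_num)]
        nlinarith [one_le_pow₀ (show (1 : ℝ) ≤ (K : ℝ) + 1 by linarith [(Nat.cast_nonneg K : (0 : ℝ) ≤ K)]) (n := 5)]
      linarith
    · have hs : Summable fun K : ℕ => 1 / ((K : ℝ) + 1) ^ 2 := by
        have h := (summable_nat_add_iff 1).mpr (Real.summable_one_div_nat_pow.mpr one_lt_two)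
        simpa [Nat.cast_add, Nat.cast_one] using h
      refine Summable.of_nonneg_of_le (fun K => le_min zero_le_one (div_nonneg (mul_nonneg (Nat.cast_nonneg _) (abs_nonneg _)) (le_max_of_le_left zero_le_one))) (fun K => ?_) hs
      have hK1 : (1 : ℝ) ≤ (K : ℝ) + 1 := by linarith [(Nat.cast_nonneg K : (0 : ℝ) ≤ K)]
      have hK0 : (0 : ℝ) < (K : ℝ) + 1 := by linarith
      -- `Δ = K + 1`
      have hΔ : ((4 * (K + 1) ^ 6 : ℕ) : ℝ) * |1 / 2 + 1 / (4 * ((K : ℝ) + 1) ^ 5) - 1 / 2| = (K : ℝ) + 1 := by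
        rw [show (1 : ℝ) / 2 + 1 / (4 * ((K : ℝ) + 1) ^ 5) - 1 / 2 = 1 / (4 * ((K : ℝ) + 1) ^ 5) by ring, abs_of_pos (by positivity)]
        push_cast; field_simp
      -- `σ ≥ (K+1)³`
      have hσ : ((K : ℝ) + 1) ^ 3 ≤ max 1 (Real.sqrt (((4 * (K + 1) ^ 6 : ℕ) : ℝ) * max (1 / 2 * (1 - 1 / 2))
          ((1 / 2 + 1 / (4 * ((K : ℝ) + 1) ^ 5)) * (1 - (1 / 2 + 1 / (4 * ((K : ℝ) + 1) ^ 5)))))) := by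
        refine le_max_of_le_right ?_
        calc ((K : ℝ) + 1) ^ 3 = Real.sqrt ((((K : ℝ) + 1) ^ 3) ^ 2) := (Real.sqrt_sq (by positivity)).symm
          _ ≤ _ := Real.sqrt_le_sqrt (by
              have : (((K : ℝ) + 1) ^ 3) ^ 2 = (4 * ((K : ℝ) + 1) ^ 6) * (1 / 2 * (1 - 1 / 2)) := by ring
              rw [this]; push_cast
              exact mul_le_mul_of_nonneg_left (le_max_left _ _) (by positivity))
      calc min 1 (((4 * (K + 1) ^ 6 : ℕ) : ℝ) * |1 / 2 + 1 / (4 * ((K : ℝ) + 1) ^ 5) - 1 / 2| /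
            max 1 (Real.sqrt (((4 * (K + 1) ^ 6 : ℕ) : ℝ) * max (1 / 2 * (1 - 1 / 2)) ((1 / 2 + 1 / (4 * ((K : ℝ) + 1) ^ 5)) * (1 - (1 / 2 + 1 / (4 * ((K : ℝ) + 1) ^ 5)))))))
          ≤ ((4 * (K + 1) ^ 6 : ℕ) : ℝ) * |1 / 2 + 1 / (4 * ((K : ℝ) + 1) ^ 5) - 1 / 2| /
            max 1 (Real.sqrt (((4 * (K + 1) ^ 6 : ℕ) : ℝ) * max (1 / 2 * (1 - 1 / 2)) ((1 / 2 + 1 / (4 * ((K : ℝ) + 1) ^ 5)) * (1 - (1 / 2 + 1 / (4 * ((K : ℝ) + 1) ^ 5)))))) :=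
            min_le_right _ _
        _ ≤ ((K : ℝ) + 1) / ((K : ℝ) + 1) ^ 3 := by
            rw [hΔ]; exact div_le_div_of_nonneg_left hK0.le (by positivity) hσ
        _ = 1 / ((K : ℝ) + 1) ^ 2 := by field_simp
  · -- the letter diverges: its terms are `K + 1 ≥ 1`
    intro h
    have ht := h.tendsto_atTop_zero
    have hev := ht.eventually (gt_mem_nhds one_pos)
    obtain ⟨K, hK⟩ := hev.exists
    have hval : ∑ _i ∈ Finset.range (4 * (K + 1) ^ 6), |1 / 2 + 1 / (4 * ((K : ℝ) + 1) ^ 5) - (1 : ℝ) / 2| = (K : ℝ) + 1 := by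
      rw [Finset.sum_const, Finset.card_range, nsmul_eq_mul,
        show (1 : ℝ) / 2 + 1 / (4 * ((K : ℝ) + 1) ^ 5) - 1 / 2 = 1 / (4 * ((K : ℝ) + 1) ^ 5) by ring, abs_of_pos (by positivity)]
      push_cast; field_simp
    rw [hval] at hK
    linarith [(Nat.cast_nonneg K : (0 : ℝ) ≤ K)]

end Summit.QuantumFields.YangMills.BalabanUVNodes.N20ProductCaricatureConditionalSum

end
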